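import Mathlib
import HarnessLib
import Literature.MathematicalPhysics.KineticTheory.HardSphereEulerProofs
import Summits.AtomisticToContinuum.HydrodynamicLimit.Theses.OneFlightGossipEngine
import Summits.AtomisticToContinuum.HydrodynamicLimit.Theorems.OneFlightGossipEngineKineticCurrentsWindowLDApriori
import Summits.AtomisticToContinuum.HydrodynamicLimit.Theorems.OneFlightGossipEngineKineticCurrentsLDAlongFamiliesFamilyModulus

/-!
# `KCWUSharp` implies the support rung `KineticCurrentsWindowLDUniform` — size certificate
# `stub_kcwuSharp_implies_rung` of line `Sketch`, crux `KineticCurrentsLDAlongFamilies` (stmt-AtomisticToContinuum-16659)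

Route `OneFlightGossipEngine`, sub-problem `HydrodynamicLimit`. The open stub S1 `stub_kcwuSharp` of the skeleton
`Cruxes/KineticCurrentsLDAlongFamilies/Lines/Sketch.lean` is the pointwise docking rung `KineticCurrentsWindowLDUniform`
(stmt-AtomisticToContinuum-14662) with the tilt threshold `β₀` moved in front of the profiles as a NUMERIC function
`β₀(Θ, U, C, Λ, σ)` of the data bounds (and the eventual window quantifier `∃ τ₀ ∀ τ ≥ τ₀`). This file kernel-certifies
that S1 is at least crux-14662-sized: its registered signature implies `KineticCurrentsWindowLDUniform` outright — read the
bounds `Θ, U, Λ` of ONE continuous positive profile triple off the compact torus, the growth constant `C ≥ 0` off the class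
bound (`growthConst_nonneg`), instantiate, and take `τ := τ₀`. (The converse direction is the research content of the line.)

References: S. Olla, S. R. S. Varadhan, H.-T. Yau, Comm. Math. Phys. 155 (1993) §1; H. Spohn, *Large Scale Dynamics of
Interacting Particles* (1991), Part I §2.3.
-/

noncomputable section

open MeasureTheory Set Filter
open scoped ENNReal Topology

namespace Summit.AtomisticToContinuum.HydrodynamicLimit.Theorems.KineticCurrentsLDAlongFamiliesSketch

open Literature.Analysis.FluidPDE (HardSphereFlow Config localMaxwellian)
open Literature.MathematicalPhysics.KineticTheory (T3 V3 hsDiameter localGibbsLaw)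
open Literature.Analysis.FluidPDE Literature.MathematicalPhysics.KineticTheory
open Summit.AtomisticToContinuum.HydrodynamicLimit.Theses.OneFlightGossipEngine (KineticCurrentsWindowLDUniform)

/-- **S1 `KCWUSharp` implies the rung `KineticCurrentsWindowLDUniform` (stmt-14662)** — size certificate
`stub_kcwuSharp_implies_rung` of line `Sketch`: the numeric-threshold pointwise rung serves in particular each single
continuous positive profile triple (bounds by compactness of `𝕋³`, growth constant non-negative by the class bound),
with the window `τ := τ₀`. Hence the open stub S1 is at least as strong as the open crux stmt-14662. [folklore] -/
theorem stub_kcwuSharp_implies_rung :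
    (∃ η₀ : ℝ, 0 < η₀ ∧ ∀ (Θ U C Λ : ℝ), 1 ≤ Θ → 0 ≤ U → 0 ≤ C → 1 ≤ Λ → ∀ σ : ℝ, 0 < σ →
    ∃ β₀ : ℝ, 0 < β₀ ∧
    ∀ (a θ₀ : T3 → ℝ) (u₀ : T3 → V3), Continuous a → Continuous θ₀ → Continuous u₀ →
    (∀ x, Λ⁻¹ ≤ a x ∧ a x ≤ Λ) → (∀ x, Θ⁻¹ ≤ θ₀ x ∧ θ₀ x ≤ Θ) → (∀ x, ‖u₀ x‖ ≤ U) →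
    σ ^ 3 * (⨆ x, a x) ≤ η₀ * ∫ x, a x →
    ∀ Φ : (N : ℕ) →
      HardSphereFlow (Literature.Analysis.FluidPDE.Torus.geometry (Fin 3)) (hsDiameter σ N) (N + 1),
    ∀ (A : T3 → Fin 3 → Fin 3 → ℝ) (b : T3 → V3) (G : T3 × ℝ → ℝ),
    Continuous A → Continuous b → Continuous G →
    ∀ F : T3 × V3 → ℝ, (∀ y, F y =
      (∑ j : Fin 3, ∑ k : Fin 3, A y.1 j k * ((y.2 - u₀ y.1) j * (y.2 - u₀ y.1) k)) +
        (∑ j : Fin 3, b y.1 j * (y.2 - u₀ y.1) j) * G (y.1, ‖y.2 - u₀ y.1‖ ^ 2)) →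
    (∀ y, |F y| ≤ C * (1 + ‖y.2‖ ^ 2)) →
    (∀ x, ∫ v, F (x, v) * localMaxwellian 1 (θ₀ x) (u₀ x) v = 0) →
    (∀ x (j : Fin 3), ∫ v, F (x, v) * v j * localMaxwellian 1 (θ₀ x) (u₀ x) v = 0) →
    (∀ x, ∫ v, F (x, v) * ‖v‖ ^ 2 * localMaxwellian 1 (θ₀ x) (u₀ x) v = 0) →
    ∀ β : ℝ, |β| ≤ β₀ → ∀ ε : ℝ, 0 < ε → ∃ τ₀ : ℝ, 0 < τ₀ ∧ ∀ τ : ℝ, τ₀ ≤ τ →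
    ∃ N₀ : ℕ, ∀ N : ℕ, N₀ ≤ N →
      ∫⁻ z, ENNReal.ofReal (Real.exp (β * ∑ i : Fin (N + 1),
          (τ * ((N : ℝ) + 1) ^ (-(1 / 3 : ℝ)))⁻¹ *
            ∫ r in (0 : ℝ)..(τ * ((N : ℝ) + 1) ^ (-(1 / 3 : ℝ))), F (((Φ N).flow r z) i)))
        ∂(localGibbsLaw σ a u₀ θ₀ N (Φ N)) ≤
      ENNReal.ofReal (Real.exp (ε * ((N : ℝ) + 1)))) →
    KineticCurrentsWindowLDUniform := by
  intro h
  obtain ⟨η₀, hη₀, hS⟩ := h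
  refine ⟨η₀, hη₀, ?_⟩
  intro a θ₀ u₀ ha hθ hu ha0 hθ0 σ hσ hguard Φ A b G hA hb hG hC h1 hv hE
  obtain ⟨C, hC⟩ := hC
  have hC0 : 0 ≤ C := growthConst_nonneg hC
  obtain ⟨Θ, hΘ1, hΘ⟩ := exists_two_sided_bound_of_continuous_pos 0 (fun _ x => θ₀ x)
    (show Continuous fun p : ℝ × T3 => θ₀ p.2 from hθ.comp continuous_snd) (fun _ x => hθ0 x)
  obtain ⟨Λ, hΛ1, hΛ⟩ := exists_two_sided_bound_of_continuous_pos 0 (fun _ x => a x)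
    (show Continuous fun p : ℝ × T3 => a p.2 from ha.comp continuous_snd) (fun _ x => ha0 x)
  obtain ⟨U, hU0, hU⟩ := exists_norm_bound_of_continuous 0 (fun _ x => u₀ x)
    (show Continuous fun p : ℝ × T3 => u₀ p.2 from hu.comp continuous_snd)
  have h0 : (0 : ℝ) ∈ Icc (0 : ℝ) 0 := ⟨le_rfl, le_rfl⟩
  obtain ⟨β₀, hβ₀, hmain⟩ := hS Θ U C Λ hΘ1 hU0 hC0 hΛ1 σ hσ
  refine ⟨β₀, hβ₀, fun β hβ ε hε => ?_⟩
  obtain ⟨τ₀, hτ₀, hτ⟩ := hmain a θ₀ u₀ ha hθ hu (fun x => hΛ 0 h0 x) (fun x => hΘ 0 h0 x)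
    (fun x => hU 0 h0 x) hguard Φ A b G hA hb hG _ (fun y => rfl) hC h1 hv hE β hβ ε hε
  obtain ⟨N₀, hN₀⟩ := hτ τ₀ le_rfl
  exact ⟨τ₀, hτ₀, N₀, hN₀⟩

end Summit.AtomisticToContinuum.HydrodynamicLimit.Theorems.KineticCurrentsLDAlongFamiliesSketch

end
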